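import Summits.ABC.IUTFork.LDHGenuineTowerArithPinned
import Summits.ABC.IUTFork.LDHGenuineStepVResidue
import Summits.ABC.IUTFork.LDHSlotResidue
import Summits.ABC.IUTFork.LDHWitness
import Literature.IUT.LogVolume.GenuineRamificationBoundsPinned
import HarnessLib

/-!
# The fork at [IUTchIII] Corollary 3.12, L-DH level, READING (U): the slot residue is absorbed by the slack of the
# printed Step (viii) constant — `T.HullEstimateOf (B_III P l)` for EVERY datum of EVERY point of log-height below an
# explicit threshold, NO slot-constancy (abc-iut cell, crux ThetaPartII = stmt-ABC-19678, RESHAPE-2 skeleton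
# 3f4b202b4c99: the registered stub `stub_hullRegime` / VERDICT RISK ¶7, QUANTIFIED)

Record-only file (D-0012) of the abc-iut cell (WAVE-3 discharge seat abc-iut-c312-d1, gen 5); TAKES NO SIDE on
[IUTchIII] Cor. 3.12 or on the (U)/(P) readings of "−|log(Θ)|". Mochizuki, *Inter-universal Teichmüller theory IV*
(RIMS manuscript Apr. 2020 = PRIMS **57** (2021)), Thm. 1.10 proof Step (v) pp. 27–29 ("we may assume that `i†` is
`j`"), Step (viii) p. 30 (`log(𝔰^≤) ≤ (4/3)·e*_mod·l` via the prime number theorem — the cell's registered constant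
`B_III(P, l)` keeps the corresponding term as `(20/3)·log(d*·l)·π(d*·l)`, `d* = 2^12·3^3·5·d_mod`).

THE OBSERVATION. In reading (U) (hull of the UNION of the (Ind1)×(Ind2)-images) the kernel has, for EVERY genuine
Θ-volume input and NO slot-constancy, `HullEstimateOf (δ_explicit + slotResidue)` (abc-iut-c312-d1
`DHData.hullEstimateOf_ofInput_min_explicit`, the `λ_min` form; abc-iut-S8: the residue is forced), where
`δ_explicit = (l+1)/4·{(1+4/l)·A + (4/l)·B + (20/3)·log(d*·l)·#{p ∈ T(I) : p ≤ d*·l}}` only COUNTS THE SUPPORT PRIMES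
below `d*·l`, whereas `B_III(P, l)` carries `π(d*·l)` in the same slot. The difference
`(l+1)/4·(20/3)·log(d*·l)·(π(d*·l) − #{p ∈ T(I) : p ≤ d*·l})` is SLACK, and it absorbs the slot residue whenever
`slotResidue ≤ slack`; since `slotResidue ≤ deĝ̲_lgp(P_Θ) = ((l+1)/24)·log(q^{∤{2,l}}(λ))` and
`#T(I)·log 2 ≤ Σ_{p∈T(I)} log p ≤ 2·d_mod·(log-diff + log 𝔣) + log(30·l)` (abc-iut-S3), the (U)-volume body holds at
every datum of every point with
`log(q^{∤{2,l}}(λ)) ≤ 40·log(d*·l)·(π(d*·l) − (2·d_mod·(log-diff + log 𝔣) + log(30·l))/log 2)`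
(numerically `π(d*·l) ≥ π(2^12·3^3·5·7) ≈ 2.7·10^5`, so the threshold is `≳ 1.6·10^8` at `l = 7`, `d_mod = 1`, and
grows like `≈ 2.2·10^7·d_mod·l`). So the (U)-reading residual of the cell (VERDICT RISK ¶7; the registered stub
`stub_hullRegime`) can only bite at log-heights `log(q) ≳ 2·10^7·d_mod·l`; with [IUTchIV] Cor. 2.2's choice
`l ≈ √(log q)` that is `log q ≳ 4·10^14·d_mod²`.

* `PilotData.slotValue_nonneg` / `ndegLgpSlotMin_nonneg` / `slotResidue_le_ndegLgpOn`, `ThetaVolumeInput.slotResidue_le_ndegLgp` —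
  `0 ≤ ndegLgpSlotMin`, `slotResidue ≤ deĝ̲_lgp(P_Θ)`;
* `PointDict.slotResidue_le_logQAvoid` — at a datum: `slotResidue(T) ≤ ((l+1)/24)·log(q^{∤{2,l}}(λ))`;
* `PointDict.hullEstimateOf_BIII_of_slotResidue_le_slack` — `T.HullEstimateOf (B_III P l)` from `slotResidue(T) ≤ slack(T)`,
  NO slot-constancy, the e-term (R4) discharged by abc-iut-S1's `Cor22.ThetaVolumeDatumAt.R4_towerFact`;
* `PointDict.card_supportPrimes_mul_log_two_le` — `#T(I)·log 2 ≤ 2·d_mod·(log-diff + log 𝔣) + log(30·l)`;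
* `PointDict.hullEstimateOf_BIII_of_logQAvoid_le` / `hullVolumeAtDatum_BIII_of_logQAvoid_le` — the (U)-volume body
  `Cor22.HullVolumeAtDatum P l (B_III P l)` at EVERY `(P, l)` (`λ ∈ U_P` minimally presented, `l ≥ 7`) below the threshold.
[cite: Mochizuki2012, IUTchIV Thm. 1.10 proof Steps (v), (viii) p. 27–30] [cite: DupuyHilado2025, §4.7, §4.11–4.12]
[claim: Mochizuki2012, status: disputed] for every IUT quotation. HONEST SCOPE: this is arithmetic on the cell's own typed
constants; it does not decide between the readings, asserts nothing about Cor. 3.12, and leaves the (U)-volume body OPEN above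
the threshold (where abc-iut-S8's `slotResidue_le_of_hullVolumeAtDatum` shows the residue must indeed be `≤ B_III`).
-/

noncomputable section

/-! ## `0 ≤ ndegLgpSlotMin`, hence `slotResidue ≤ ndegLgpOn` -/

namespace Literature.IUT.LogVolume

namespace PilotData

open NumberField IsDedekindDomain Finset

variable {F : Type} [Field F] [NumberField F] (X : PilotData F)

/-- The slot values `θ_j(v) = P_{Θ,j}(v)·ln|κ(v)|/n_v` are `≥ 0` (`P_{Θ,j}(v) ≥ 0`: abc-iut-c312-3's
`ValLine.thetaPilot_nonneg`). [cite: DupuyHilado2025, §3.4] -/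
theorem slotValue_nonneg (i : Fin X.lstar) (v : HeightOneSpectrum (𝓞 F)) : 0 ≤ X.slotValue i v := by
  unfold slotValue
  exact div_nonneg (mul_nonneg (Summit.ABC.IUTFork.ValLine.thetaPilot_nonneg X i v) (logNorm_pos F v).le)
    (Nat.cast_nonneg _)

/-- **The least-slot aggregate is `≥ 0`.** [cite: DupuyHilado2025, §4.7] -/
theorem ndegLgpSlotMin_nonneg (T : Finset ℕ) : 0 ≤ X.ndegLgpSlotMin T := by
  unfold ndegLgpSlotMin
  refine Finset.sum_nonneg fun p _ => mul_nonneg (by positivity) (Finset.sum_nonneg fun i _ =>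
    Finset.sum_nonneg fun e _ => mul_nonneg ?_ (prod_weight_nonneg e))
  obtain ⟨k, _, hk⟩ := Finset.exists_mem_eq_inf' Finset.univ_nonempty (fun k => X.slotValue i (e k).1)
  rw [hk]
  exact X.slotValue_nonneg i _

/-- `slotResidue ≤ ndegLgpOn` (the residue is at most the last-slot aggregate). [cite: DupuyHilado2025, §4.7] -/
theorem slotResidue_le_ndegLgpOn (T : Finset ℕ) : X.slotResidue T ≤ X.ndegLgpOn T := by
  unfold slotResidue
  linarith [X.ndegLgpSlotMin_nonneg T]

end PilotData

namespace ThetaVolumeInput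

variable {F₀ : Type} [Field F₀] [NumberField F₀] {K : Type} [Field K] [NumberField K] [Algebra F₀ K]
variable (I : ThetaVolumeInput F₀ K)

/-- **For a genuine Θ-volume input, `slotResidue(P_Θ; T(I)) ≤ deĝ̲_lgp(P_Θ)`** (`ndegLgpOn = deĝ̲_lgp` on the support
primes, abc-iut-S8 `DHData.slotResidue_eq`, and `ndegLgpSlotMin ≥ 0`). [cite: DupuyHilado2025, Thm. 3.10.1, §4.7] -/
theorem slotResidue_le_ndegLgp : I.X.slotResidue I.supportPrimes ≤ LgpDivisor.ndegLgp I.X.thetaPilot := by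
  have h : I.X.slotResidue I.supportPrimes = LgpDivisor.ndegLgp I.X.thetaPilot - I.X.ndegLgpSlotMin I.supportPrimes :=
    (Summit.ABC.IUTFork.DHData.ofInput I).slotResidue_eq
  rw [h]
  linarith [I.X.ndegLgpSlotMin_nonneg I.supportPrimes]

end ThetaVolumeInput

end Literature.IUT.LogVolume

namespace Summit.ABC.IUTFork

open Literature.IUT.HodgeTheaters Literature.IUT.LogVolume NumberField IsDedekindDomain
open Literature.NumberTheory.DiophantineGeometry.GenEll
open scoped Nat.Prime

namespace PointDict

variable {P : NFPoint} {l : ℕ}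

/-- `log((2^12·3^3·5·d)·l) ≥ 0` for `d, l ≥ 1`. [cite: Mochizuki2012, IUTchIV Thm. 1.10 p. 22] -/
private theorem log_dstar_mul_nonneg₃ {d l : ℕ} (hd : 1 ≤ d) (hl : 1 ≤ l) :
    0 ≤ Real.log (((2 ^ 12 * 3 ^ 3 * 5 * d : ℕ) : ℝ) * l) := by
  apply Real.log_nonneg
  have h1 : (1 : ℝ) ≤ ((2 ^ 12 * 3 ^ 3 * 5 * d : ℕ) : ℝ) := by exact_mod_cast (by nlinarith : 1 ≤ 2 ^ 12 * 3 ^ 3 * 5 * d)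
  have h2 : (1 : ℝ) ≤ (l : ℝ) := by exact_mod_cast hl
  nlinarith

/-- **At a genuine datum: `slotResidue(T) ≤ ((l+1)/24)·log(q^{∤{2,l}}(λ))`** — the residue is at most
`deĝ̲_lgp(P_Θ)`, which is `((l+1)/24)·deĝ̲(𝔮)` (abc-iut-c312-3 / abc-iut-c312-d1 `DHData.ndegLgp_thetaPilot_eq`) with `deĝ̲(𝔮) = log(q)`
of the datum `= log(q^{∤{2,l}}(λ))` (abc-iut-S2/c312-8 `Cor312Prov.ndeg_qDivisor_pilotData_eq_logq`,
`logq_eq_logQAvoid_of_j_extend` under the (P5) choice). [cite: Mochizuki2012, IUTchIV Thm. 1.10 Step (v) p. 27–28]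
[cite: DupuyHilado2025, §3.3, §4.7] -/
theorem slotResidue_le_logQAvoid (T : Cor22.ThetaVolumeDatumAt P l) :
    (letI := T.instFieldF; letI := T.instNumberFieldF; letI := T.instFieldK; letI := T.instNumberFieldK
     letI := T.instAlgebraK
     T.I.X.slotResidue T.I.supportPrimes) ≤ ((l : ℝ) + 1) / 24 * Cor22.logQAvoid P {2, l} := by
  letI := T.instFieldF; letI := T.instNumberFieldF; letI := T.instAlgebraF; letI := T.instFieldK
  letI := T.instNumberFieldK; letI := T.instAlgebraK; letI := T.instFieldFbar; letI := T.instAlgebraFbar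
  letI := T.instAlgebraKFbar; letI := T.instIsElliptic
  refine (T.I.slotResidue_le_ndegLgp).trans (le_of_eq ?_)
  rw [DHData.ndegLgp_thetaPilot_eq, T.isVolumeInputOf.X_eq, ThetaData.pilotData_l,
    Cor312Prov.ndeg_qDivisor_pilotData_eq_logq T.D, Cor312Prov.logq_eq_logQAvoid_of_j_extend T.j_eq T.D T.isP5Choice]

/-- **READING (U), NO SLOT-CONSTANCY: `T.HullEstimateOf (B_III P l)` whenever the slot residue fits into the slack of the
Step (viii) term** — for `λ ∈ U_P` (minimally presented), `l ≥ 7` and a genuine Θ-volume datum `T` at `(P, l)`: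
if `slotResidue(T) ≤ (l+1)/4·(20/3)·log(d*·l)·(π(d*·l) − #{p ∈ T(I) : p ≤ d*·l})` then `T.HullEstimateOf (B_III P l)`
(exact registered bytes of `B_III`). Composition: abc-iut-c312-d1 `DHData.hullEstimateOf_ofInput_min_explicit`
(`HullEstimateOf (δ_explicit + slotResidue)`, every input) at `N := d*·l`, `l* := log(d*·l)`, with the e-term (R4) of
abc-iut-S1 (`Cor22.ThetaVolumeDatumAt.R4_towerFact`); the Step (ii)/(iii) bounds of abc-iut-S1/S-d1/S3 exactly as in
abc-iut-S3's `deltaExplicit_le_BIII_pinned`; abc-iut-S3's `Cor22.deltaK_le_BIII_of_le21` applied with `sLe := π(d*·l)`,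
the slack being the difference to the true count. [cite: Mochizuki2012, IUTchIV Thm. 1.10 proof Steps (ii)–(viii) p. 24–30]
[claim: Mochizuki2012, status: disputed] -/
theorem hullEstimateOf_BIII_of_slotResidue_le_slack (T : Cor22.ThetaVolumeDatumAt P l) (hP : P ∈ UP) (h7 : 7 ≤ l)
    (hres : letI := T.instFieldF; letI := T.instNumberFieldF; letI := T.instFieldK; letI := T.instNumberFieldK
      letI := T.instAlgebraK
      T.I.X.slotResidue T.I.supportPrimes ≤
        ((l : ℝ) + 1) / 4 * (20 / 3 * Real.log (((2 ^ 12 * 3 ^ 3 * 5 * Cor22.dmod P : ℕ) : ℝ) * l)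
          * ((Nat.primeCounting (2 ^ 12 * 3 ^ 3 * 5 * Cor22.dmod P * l) : ℝ)
            - ((T.I.supportPrimes.filter (· ≤ 2 ^ 12 * 3 ^ 3 * 5 * Cor22.dmod P * l)).card : ℝ)))) :
    T.HullEstimateOf (((l : ℝ) + 1) / 4 * ((1 + 12 * (Cor22.dmod P : ℝ) / l) * (P.logDiff + Cor22.logCondAvoid P {2, l})
      + 2 * Real.log l + 52 + 20 / 3 * Real.log (((2 ^ 12 * 3 ^ 3 * 5 * Cor22.dmod P : ℕ) : ℝ) * (l : ℝ))
        * (Nat.primeCounting (2 ^ 12 * 3 ^ 3 * 5 * Cor22.dmod P * l) : ℝ))) := by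
  classical
  letI := T.instFieldF; letI := T.instNumberFieldF; letI := T.instAlgebraF; letI := T.instFieldK
  letI := T.instNumberFieldK; letI := T.instAlgebraK; letI := T.instFieldFbar; letI := T.instAlgebraFbar
  letI := T.instAlgebraKFbar; letI := T.instIsElliptic
  have hU : P.InU := hP.1
  have hl : l.Prime := T.D.l_prime
  have h5 : 5 ≤ l := by omega
  have hl1 : 1 ≤ l := by omega
  have hd : 1 ≤ Cor22.dmod P := Cor22.dmod_pos P
  have hXl : ((T.I.X.l : ℕ) : ℝ) = (l : ℝ) := by exact_mod_cast T.isVolumeInputOf.l_eq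
  haveI : IsGalois (fieldOfModuli T.E) T.K := T.isGalois_fieldOfModuli_K
  have hprimes : ∀ p ∈ T.I.supportPrimes, p.Prime := fun p hp => T.I.prime_of_mem_supportPrimes hp
  have hlmod := log_dstar_mul_nonneg₃ hd hl1
  -- S-a in the `λ_min` form: `HullEstimateOf (δ_explicit + slotResidue)`, every datum, (R4) by abc-iut-S1
  have h0 := DHData.hullEstimateOf_ofInput_min_explicit T.I (2 ^ 12 * 3 ^ 3 * 5 * Cor22.dmod P * l) hlmod
    (T.R4_towerFact hP)
  rw [hXl] at h0
  -- `A ≤ log 𝔡^K ≤ log-diff + log 𝔣 + 2·log l + 21`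
  have hA1 := sum_dite_localDegree_mul_differentOrd_le_ndeg (fieldOfModuli T.E) T.K T.I.σ T.I.supportPrimes hprimes
  have hA2 := T.ndeg_differentDivisor_le hU h7
  have hA : (∑ p ∈ T.I.supportPrimes, if hp : p.Prime then haveI : Fact p.Prime := ⟨hp⟩
        (∑ v : placesOver (fieldOfModuli T.E) p, (localDegree (fieldOfModuli T.E) v.1 : ℝ) *
          differentOrd p ((T.I.σ.localFieldFamily p hp).k v)) / Module.finrank ℚ (fieldOfModuli T.E) * Real.log p
        else 0) ≤ P.logDiff + Cor22.logCondAvoid P {2, l} + 2 * Real.log l + 21 := hA1.trans hA2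
  -- `B ≤ 2·d_mod·(log-diff + log 𝔣) + log(30·l)`
  have hB := T.sum_log_supportPrimes_le_pinned hP
  -- tower arithmetic with `sLe := π(d*·l)` itself: the full Step (viii) term
  have hδ := Cor22.deltaK_le_BIII_of_le21 (P := P) hl h5 hd le_rfl hA hB
    (le_refl ((π (2 ^ 12 * 3 ^ 3 * 5 * Cor22.dmod P * l) : ℝ)))
  have e : (((2 ^ 12 * 3 ^ 3 * 5 * Cor22.dmod P : ℕ) : ℝ) * l) = ((2 : ℝ) ^ 12 * 3 ^ 3 * 5 * (Cor22.dmod P) * l) := by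
    push_cast; ring
  rw [e] at hres h0
  refine T.hullEstimateOf_mono h0 ?_
  have hc0 : (0 : ℝ) ≤ ((l : ℝ) + 1) / 4 := by positivity
  -- `δ_explicit(count) + slotResidue ≤ δ_explicit(count) + slack = δ_explicit(π) ≤ B_III`
  nlinarith [hδ, hres, hc0]

/-- **`#T(I)·log 2 ≤ Σ_{p ∈ T(I)} log p ≤ 2·d_mod·(log-diff + log 𝔣^{∤{2,l}}) + log(2·3·5·l)`** for a genuine datum at a
point `λ ∈ U_P` (every support prime is `≥ 2`; abc-iut-S3's `sum_log_supportPrimes_le_pinned`), hence the count of support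
primes below `d*·l` is at most `(2·d_mod·(log-diff + log 𝔣) + log(30·l))/log 2`.
[cite: Mochizuki2012, IUTchIV Thm. 1.10 proof Step (iii) p. 26] -/
theorem card_supportPrimes_filter_le (T : Cor22.ThetaVolumeDatumAt P l) (hP : P ∈ UP) (N : ℕ) :
    (letI := T.instFieldF; letI := T.instNumberFieldF; letI := T.instFieldK; letI := T.instNumberFieldK
     letI := T.instAlgebraK
     (((T.I.supportPrimes.filter (· ≤ N)).card : ℝ))) ≤
      (2 * (Cor22.dmod P : ℝ) * (P.logDiff + Cor22.logCondAvoid P {2, l}) + Real.log (2 * 3 * 5 * (l : ℝ))) / Real.log 2 := by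
  classical
  letI := T.instFieldF; letI := T.instNumberFieldF; letI := T.instAlgebraF; letI := T.instFieldK
  letI := T.instNumberFieldK; letI := T.instAlgebraK; letI := T.instFieldFbar; letI := T.instAlgebraFbar
  letI := T.instAlgebraKFbar; letI := T.instIsElliptic
  have hB := T.sum_log_supportPrimes_le_pinned hP
  have hlog2 : (0 : ℝ) < Real.log 2 := Real.log_pos (by norm_num)
  rw [le_div_iff₀ hlog2]
  have h1 : (((T.I.supportPrimes.filter (· ≤ N)).card : ℝ)) ≤ (T.I.supportPrimes.card : ℝ) := by
    exact_mod_cast Finset.card_filter_le _ _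
  have h2 : (T.I.supportPrimes.card : ℝ) * Real.log 2 ≤ ∑ p ∈ T.I.supportPrimes, Real.log p := by
    rw [← nsmul_eq_mul, ← Finset.sum_const]
    refine Finset.sum_le_sum fun p hp => Real.log_le_log (by norm_num) ?_
    exact_mod_cast (T.I.prime_of_mem_supportPrimes hp).two_le
  nlinarith [h1, h2, hlog2.le]

/-- **READING (U), NO SLOT-CONSTANCY, BELOW THE HEIGHT THRESHOLD: `T.HullEstimateOf (B_III P l)`** for `λ ∈ U_P`
(minimally presented), `l ≥ 7`, every genuine Θ-volume datum `T` at `(P, l)`, PROVIDED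
`log(q^{∤{2,l}}(λ)) ≤ 40·log(d*·l)·(π(d*·l) − (2·d_mod·(log-diff + log 𝔣^{∤{2,l}}) + log(30·l))/log 2)` — the slot
residue (`≤ ((l+1)/24)·log q`) then fits into the slack of the Step (viii) term. VERDICT RISK ¶7 quantified: the
(U)-reading residual can only bite above this threshold (`≈ 2.2·10^7·d_mod·l`). [cite: Mochizuki2012, IUTchIV Thm. 1.10
proof Steps (v), (viii) p. 27–30] [claim: Mochizuki2012, status: disputed] -/
theorem hullEstimateOf_BIII_of_logQAvoid_le (T : Cor22.ThetaVolumeDatumAt P l) (hP : P ∈ UP) (h7 : 7 ≤ l)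
    (h : Cor22.logQAvoid P {2, l} ≤
      40 * Real.log (((2 ^ 12 * 3 ^ 3 * 5 * Cor22.dmod P : ℕ) : ℝ) * l)
        * ((Nat.primeCounting (2 ^ 12 * 3 ^ 3 * 5 * Cor22.dmod P * l) : ℝ)
          - (2 * (Cor22.dmod P : ℝ) * (P.logDiff + Cor22.logCondAvoid P {2, l}) + Real.log (2 * 3 * 5 * (l : ℝ)))
            / Real.log 2)) :
    T.HullEstimateOf (((l : ℝ) + 1) / 4 * ((1 + 12 * (Cor22.dmod P : ℝ) / l) * (P.logDiff + Cor22.logCondAvoid P {2, l})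
      + 2 * Real.log l + 52 + 20 / 3 * Real.log (((2 ^ 12 * 3 ^ 3 * 5 * Cor22.dmod P : ℕ) : ℝ) * (l : ℝ))
        * (Nat.primeCounting (2 ^ 12 * 3 ^ 3 * 5 * Cor22.dmod P * l) : ℝ))) := by
  letI := T.instFieldF; letI := T.instNumberFieldF; letI := T.instAlgebraF; letI := T.instFieldK
  letI := T.instNumberFieldK; letI := T.instAlgebraK; letI := T.instIsElliptic
  have hl1 : 1 ≤ l := by omega
  have hd : 1 ≤ Cor22.dmod P := Cor22.dmod_pos P
  have hlmod := log_dstar_mul_nonneg₃ hd hl1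
  refine hullEstimateOf_BIII_of_slotResidue_le_slack T hP h7 ?_
  have hres := slotResidue_le_logQAvoid T
  have hcnt := card_supportPrimes_filter_le T hP (2 ^ 12 * 3 ^ 3 * 5 * Cor22.dmod P * l)
  have hl0 : (0 : ℝ) ≤ ((l : ℝ) + 1) / 24 := by positivity
  -- `slotResidue ≤ ((l+1)/24)·log q ≤ ((l+1)/24)·40·L·(π − bound/log 2) ≤ (l+1)/4·(20/3)·L·(π − count)`
  have h1 := mul_le_mul_of_nonneg_left h hl0
  have h2 : Real.log (((2 ^ 12 * 3 ^ 3 * 5 * Cor22.dmod P : ℕ) : ℝ) * l) *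
      ((Nat.primeCounting (2 ^ 12 * 3 ^ 3 * 5 * Cor22.dmod P * l) : ℝ)
        - (2 * (Cor22.dmod P : ℝ) * (P.logDiff + Cor22.logCondAvoid P {2, l}) + Real.log (2 * 3 * 5 * (l : ℝ)))
          / Real.log 2) ≤
      Real.log (((2 ^ 12 * 3 ^ 3 * 5 * Cor22.dmod P : ℕ) : ℝ) * l) *
        ((Nat.primeCounting (2 ^ 12 * 3 ^ 3 * 5 * Cor22.dmod P * l) : ℝ)
          - ((T.I.supportPrimes.filter (· ≤ 2 ^ 12 * 3 ^ 3 * 5 * Cor22.dmod P * l)).card : ℝ)) :=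
    mul_le_mul_of_nonneg_left (by linarith) hlmod
  nlinarith [hres, h1, h2, hl0]

/-- **The `∀ T` form: `Cor22.HullVolumeAtDatum P l (B_III P l)` in READING (U), NO slot-constancy, at every `(P, l)`
with `λ ∈ U_P` (minimally presented), `l ≥ 7`, below the height threshold** — i.e. the body of the (U)-line's volume
edge (ii′) (and of the registered stub `stub_hullRegime`) at such points. OPEN above the threshold (VERDICT RISK ¶7).
[cite: Mochizuki2012, IUTchIV Thm. 1.10 proof Steps (v), (viii) p. 27–30] [claim: Mochizuki2012, status: disputed] -/
theorem hullVolumeAtDatum_BIII_of_logQAvoid_le (hP : P ∈ UP) (h7 : 7 ≤ l)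
    (h : Cor22.logQAvoid P {2, l} ≤
      40 * Real.log (((2 ^ 12 * 3 ^ 3 * 5 * Cor22.dmod P : ℕ) : ℝ) * l)
        * ((Nat.primeCounting (2 ^ 12 * 3 ^ 3 * 5 * Cor22.dmod P * l) : ℝ)
          - (2 * (Cor22.dmod P : ℝ) * (P.logDiff + Cor22.logCondAvoid P {2, l}) + Real.log (2 * 3 * 5 * (l : ℝ)))
            / Real.log 2)) :
    Cor22.HullVolumeAtDatum P l (((l : ℝ) + 1) / 4 * ((1 + 12 * (Cor22.dmod P : ℝ) / l)
      * (P.logDiff + Cor22.logCondAvoid P {2, l}) + 2 * Real.log l + 52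
        + 20 / 3 * Real.log (((2 ^ 12 * 3 ^ 3 * 5 * Cor22.dmod P : ℕ) : ℝ) * (l : ℝ))
          * (Nat.primeCounting (2 ^ 12 * 3 ^ 3 * 5 * Cor22.dmod P * l) : ℝ))) :=
  fun T => hullEstimateOf_BIII_of_logQAvoid_le T hP h7 h

end PointDict

end Summit.ABC.IUTFork

end
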